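import Literature.Analysis.FluidPDE.NSHopfGalerkinExistence
import HarnessLib

/-!
# The Fourier–Galerkin scheme for the passive solenoidal vector (`A = 0`) on `T^d` with a
  trigonometric-polynomial carrier, I: the truncated system, invariant supports, energy decay,
  global existence

Analysis/FluidPDE proof-support file (definitions with bodies + theorems; no named facts). First file
of the construction of weak solutions of the LINEAR passive-vector equation
`∂ₜw + (b·∇)w + ∇π = κΔw`, `∇·w = 0` (Yoshida–Kaneda 2000, eq. (4)–(5) with `(α, β) = (0, 1)`; weak
class `Torus.IsWeakPassiveVectorOn 0` of `PassiveVector.lean`) around a carrier which is, at every time,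
a real divergence-free vector trigonometric polynomial `b(t) = realTrigPoly S (β t)` with coefficients
supported in the (finite, symmetric) Galerkin frequency set `S` — the case of the lattice-shear-word cell
carriers `LatticeWord.cell` of `LatticeShearWords.lean` (each frozen Kolmogorov layer is a single real
Fourier mode). It is the linear twin of the tree's Navier–Stokes Galerkin system (`NSGalerkinFourier`,
`NSHopfGalerkinExistence`; Robinson–Rodrigo–Sadowski 2016, Thm. 4.4 Steps 1–2; Constantin–Foias 1988,
Ch. 8, (8.3)–(8.9)), with the quadratic convection symbol `convectionCoeff S c c` replaced by the bilinear
one `convectionCoeff S β c` (carrier × state):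

* `Torus.pvGalerkinField κ S β c k = -κ 4π²|k|² c k - Π_k convectionCoeff S β c k` and its restriction
  `pvGalerkinRHS S κ β c` to coefficient vectors on `S`;
* invariance of the real divergence-free phase space (`pvGalerkinRHS_mem`) and, more precisely, of the
  sub-phase-space `pvPhase S Sec` of coefficient vectors supported in a frequency set `Sec` that is stable
  under translation by the carrier frequencies and vanishing at `k = 0` (`pvGalerkinRHS_mem_pvPhase`):
  the Galerkin flow **preserves Bloch sectors and the zero mode** (the zero-mode equation is
  `ċ₀ = -convectionCoeff S β c 0 = 0` by transversality of the carrier);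
* the **energy identity** `∑_k Re⟪c k, V k⟫ = -κ‖∇u‖²` (`sum_re_inner_pvGalerkinField_self`: the
  transport term drops out, `∫⟪u, (b·∇)u⟫ = 0` for `div b = 0`), the differential form along solutions
  and the **sector-Poincaré decay** `∑‖α t k‖² ≤ e^{-8π²κR²t} ∑‖α 0 k‖²` when `R² ≤ |k|²` on `Sec`
  (`energy_decay_of_solution`, Grönwall);
* **global existence** of phase-space-valued solutions for continuous real transversal carrier
  coefficients (`exists_pvGalerkin_solution`; `ODE.exists_solution_of_apriori_bound` with the linear
  Lipschitz bound and the a priori bound from the energy identity).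

The passage to the limit `S = freqBall N → ℤ^d` and the weak formulation are carried out in the sequel.

## References

* K. Yoshida, Y. Kaneda, Phys. Rev. E 63 (2000) 016308, §II eq. (4)–(5). [`YoshidaKaneda2000`]
* J. C. Robinson, J. L. Rodrigo, W. Sadowski, *The three-dimensional Navier–Stokes equations*
  (CUP 2016), §4.1, Thm. 4.4 Steps 1–2, (4.2)–(4.8). [`RobinsonRodrigoSadowski2016`]
* P. Constantin, C. Foias, *Navier–Stokes Equations* (Chicago 1988), Ch. 8, (8.3)–(8.9). [`ConstantinFoias1988`]
-/

open MeasureTheory Set Filter Topology UnitAddTorus Metric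
open scoped ENNReal NNReal InnerProductSpace

noncomputable section

namespace Literature.Analysis.FluidPDE

/-! ## The field on coefficient families `ℤ^d → ℂ^d` -/

namespace Torus

open FunctionSpaces.Torus

variable {d : Type*} [Fintype d]

section Field

variable {S : Finset (d → ℤ)}

/-- **The Fourier–Galerkin vector field of the passive solenoidal vector** with viscosity `κ` on the
frequency set `S`, around the carrier with coefficients `β`:
`pvGalerkinField κ S β c k = -κ 4π²|k|² c k - Π_k convectionCoeff S β c k`, the `k`-th coefficient of
`κΔu - P[(b·∇)u]` for `b = realTrigPoly S β`, `u = realTrigPoly S c` (the LINEAR analogue of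
`Torus.galerkinField`; Yoshida–Kaneda 2000 (4)–(5) with `α = 0`, Galerkin-truncated as in
Robinson–Rodrigo–Sadowski 2016, (4.5)). [cite: RobinsonRodrigoSadowski2016, Thm. 4.4 Step 1 (4.5)] -/
def pvGalerkinField (κ : ℝ) (S : Finset (d → ℤ)) (β c : (d → ℤ) → EuclideanSpace ℂ d)
    (k : d → ℤ) : EuclideanSpace ℂ d :=
  -(((κ * (4 * Real.pi ^ 2 * freqNormSq k) : ℝ) : ℂ) • c k) - leraySym k (convectionCoeff S β c k)

/-- Unfolding of `pvGalerkinField`. [cite: RobinsonRodrigoSadowski2016, Thm. 4.4 Step 1 (4.5)] -/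
theorem pvGalerkinField_def (κ : ℝ) (S : Finset (d → ℤ)) (β c : (d → ℤ) → EuclideanSpace ℂ d)
    (k : d → ℤ) :
    pvGalerkinField κ S β c k =
      -(((κ * (4 * Real.pi ^ 2 * freqNormSq k) : ℝ) : ℂ) • c k) - leraySym k (convectionCoeff S β c k) := rfl

/-- **Transversality**: `∑ᵢ kᵢ V(c)_k,i = 0` whenever `c k` is transversal (Stokes term parallel to
`c k`, convection term Leray-projected): the Galerkin system leaves the divergence-free coefficients
invariant (Constantin–Foias 1988, (8.3)–(8.5), `P_m H`). [cite: ConstantinFoias1988, Ch. 8 (8.3)–(8.5)] -/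
theorem sum_mul_pvGalerkinField_apply (κ : ℝ) (S : Finset (d → ℤ))
    (β c : (d → ℤ) → EuclideanSpace ℂ d) {k : d → ℤ} (hck : ∑ i, (k i : ℂ) * c k i = 0) :
    ∑ i, (k i : ℂ) * pvGalerkinField κ S β c k i = 0 := by
  have h1 : ∑ i, (k i : ℂ) * ((((κ * (4 * Real.pi ^ 2 * freqNormSq k) : ℝ) : ℂ) • c k) i) =
      (((κ * (4 * Real.pi ^ 2 * freqNormSq k) : ℝ) : ℂ)) * ∑ i, (k i : ℂ) * c k i := by
    rw [Finset.mul_sum]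
    refine Finset.sum_congr rfl fun i _ => ?_
    rw [PiLp.smul_apply, smul_eq_mul]
    ring
  simp only [pvGalerkinField, PiLp.sub_apply, PiLp.neg_apply, mul_sub, mul_neg,
    Finset.sum_sub_distrib, Finset.sum_neg_distrib, sum_mul_leraySym_apply, h1, hck, mul_zero,
    neg_zero, sub_zero]

/-- The field preserves transversality on `S` (invariance of `P_m H`). [cite: ConstantinFoias1988, Ch. 8 (8.3)–(8.5)] -/
theorem isTransversal_pvGalerkinField (κ : ℝ) {S : Finset (d → ℤ)}
    (β : (d → ℤ) → EuclideanSpace ℂ d) {c : (d → ℤ) → EuclideanSpace ℂ d}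
    (hc : IsTransversal S c) : IsTransversal S (pvGalerkinField κ S β c) :=
  fun k hk => sum_mul_pvGalerkinField_apply κ S β c (hc k hk)

/-- **Conjugate symmetry** of the field for conjugate-symmetric carrier and state coefficients on a
symmetric `S` (the flow preserves real fields; invariance of the real Galerkin space). [cite: ConstantinFoias1988, Ch. 8 (8.3)–(8.5)] -/
theorem _root_.Literature.Analysis.FunctionSpaces.Torus.IsConjSymm.pvGalerkinField (κ : ℝ)
    {S : Finset (d → ℤ)} (hS : ∀ k ∈ S, -k ∈ S)
    {β c : (d → ℤ) → EuclideanSpace ℂ d} (hβ : IsConjSymm β) (hc : IsConjSymm c) :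
    IsConjSymm (pvGalerkinField κ S β c) := by
  intro k
  have hcc := (hβ.convectionCoeff hS hc) k
  rw [pvGalerkinField_def, pvGalerkinField_def, FunctionSpaces.EuclideanSpace.conjVec_sub,
    FunctionSpaces.EuclideanSpace.conjVec_neg, FunctionSpaces.EuclideanSpace.conjVec_smul, Complex.conj_ofReal,
    freqNormSq_neg, hc k, leraySym_neg_freq, hcc, conjVec_leraySym]

/-- **The zero mode is stationary**: `V(c) 0 = 0` when `c 0 = 0` and the carrier is transversal on `S`
(`∑ⱼ lⱼ β l j = 0`): the only contributions to `convectionCoeff S β c 0` come from `l + m = 0`, and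
`β l · m = -β l · l = 0` (the mean is conserved by the truncated transport–diffusion system). [cite: ConstantinFoias1988, Ch. 8 (8.3)–(8.5)] -/
theorem pvGalerkinField_zero_freq (κ : ℝ) {S : Finset (d → ℤ)} {β c : (d → ℤ) → EuclideanSpace ℂ d}
    (hβT : IsTransversal S β) (hc0 : c 0 = 0) : pvGalerkinField κ S β c 0 = 0 := by
  have hconv : convectionCoeff S β c 0 = 0 := by
    rw [convectionCoeff_def]
    refine Finset.sum_eq_zero fun l hl => Finset.sum_eq_zero fun m _ => ?_
    split_ifs with h
    · have hm : m = -l := eq_neg_of_add_eq_zero_right h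
      have hz : ∑ j, β l j * (m j : ℂ) = 0 := by
        rw [hm]
        have := hβT l hl
        calc ∑ j, β l j * ((-l) j : ℂ) = -∑ j, (l j : ℂ) * β l j := by
              rw [← Finset.sum_neg_distrib]
              refine Finset.sum_congr rfl fun j _ => ?_
              simp only [Pi.neg_apply, Int.cast_neg]; ring
          _ = 0 := by rw [this, neg_zero]
      rw [hz, mul_zero, zero_smul]
    · rfl
  rw [pvGalerkinField_def, hconv, leraySym_zero, sub_zero, hc0, smul_zero, neg_zero]

/-- **Support propagation**: if `c` vanishes off a set `Sec` which is stable under translation by the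
frequencies where `β` does not vanish (`k - l ∈ Sec`, `β l ≠ 0` ⇒ `k ∈ Sec`), then `V(c)` vanishes off `Sec`
(mode `k` is fed only by the modes `k - l`, `l` a carrier frequency: the convolution structure of the
truncated transport term, Constantin–Foias 1988, (8.5)). [cite: ConstantinFoias1988, Ch. 8 (8.3)–(8.5)] -/
theorem pvGalerkinField_eq_zero_of_support (κ : ℝ) {S : Finset (d → ℤ)} {Sec : Set (d → ℤ)}
    {β c : (d → ℤ) → EuclideanSpace ℂ d}
    (hSec : ∀ k l, β l ≠ 0 → k - l ∈ Sec → k ∈ Sec) (hc : ∀ k, k ∉ Sec → c k = 0) {k : d → ℤ} (hk : k ∉ Sec) :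
    pvGalerkinField κ S β c k = 0 := by
  have hconv : convectionCoeff S β c k = 0 := by
    rw [convectionCoeff_def]
    refine Finset.sum_eq_zero fun l _ => Finset.sum_eq_zero fun m _ => ?_
    split_ifs with h
    · by_cases hβl : β l = 0
      · simp [hβl]
      · have hm : m = k - l := by rw [← h]; abel
        have hmSec : m ∉ Sec := fun hmSec => hk (hSec k l hβl (hm ▸ hmSec))
        rw [hc m hmSec, smul_zero]
    · rfl
  rw [pvGalerkinField_def, hconv, leraySym_zero, sub_zero, hc k hk, smul_zero, neg_zero]

/-! ### The energy identity -/

/-- `∫ ⟪u, (b·∇)u⟫ = 0` for smooth `u` and a smooth divergence-free `b`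
(`⟪u, (b·∇)u⟫ = ½ D‖u‖²[b]`, and `∫ Dθ[b] = 0`; antisymmetry of the trilinear form `b(u,v,v) = 0`,
Robinson–Rodrigo–Sadowski 2016, Lemma 3.2). [cite: RobinsonRodrigoSadowski2016, Lemma 3.2] -/
theorem integral_inner_convect_right_self_eq_zero [DecidableEq d]
    {b u : UnitAddTorus d → EuclideanSpace ℝ d}
    (hb : IsSmooth b) (hbdiv : IsDivFree b) (hu : IsSmooth u) :
    ∫ x, ⟪u x, FunctionSpaces.Torus.convect b u x⟫_ℝ = 0 := by
  have h : ∀ x, ⟪u x, FunctionSpaces.Torus.convect b u x⟫_ℝ =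
      2⁻¹ * FunctionSpaces.Torus.fderiv (fun y => ‖u y‖ ^ 2) x (b x) := by
    intro x
    rw [fderiv_norm_sq_apply (hu.isContDiff (by simp)), FunctionSpaces.Torus.convect]
    ring
  simp_rw [h, integral_const_mul, integral_fderiv_apply_eq_zero_of_isDivFree hb hu.norm_sq hbdiv, mul_zero]

variable [DecidableEq d]

/-- **The energy identity of the passive-vector Galerkin system**: for real (conjugate-symmetric)
divergence-free (transversal) `c` and a real divergence-free carrier `β` on a symmetric `S`,
`∑_{k∈S} Re⟪c k, pvGalerkinField κ S β c k⟫ = -κ ‖∇u‖²_{L²}`, `u = realTrigPoly S c`,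
`‖∇u‖²_{L²} = (eGradNormSq u).toReal`: the transport term drops out because
`∑_{k∈S} Re⟪c k, 𝓕[(b·∇)u](k)⟫ = ∫⟪u, (b·∇)u⟫ = 0` (the `A = 0` energy identity
`d/dt ½‖w‖² = -κ‖∇w‖²` at the Galerkin level; RRS 2016, (4.6)–(4.7) without the nonlinearity). [cite: RobinsonRodrigoSadowski2016, Thm. 4.4 Step 2 (4.6)–(4.7)] -/
theorem sum_re_inner_pvGalerkinField_self (κ : ℝ) (hS : ∀ k ∈ S, -k ∈ S)
    {β c : (d → ℤ) → EuclideanSpace ℂ d} (hβ : IsConjSymm β) (hβT : IsTransversal S β)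
    (hc : IsConjSymm c) (hcT : IsTransversal S c) :
    ∑ k ∈ S, (inner ℂ (c k) (pvGalerkinField κ S β c k)).re =
      -(κ * (eGradNormSq (realTrigPoly S c)).toReal) := by
  have hu : IsSmooth (realTrigPoly S c) := isSmooth_realTrigPoly S c
  have hb : IsSmooth (realTrigPoly S β) := isSmooth_realTrigPoly S β
  have hbdiv : IsDivFree (realTrigPoly S β) := isDivFree_realTrigPoly hβT
  have hsplit : ∀ k ∈ S, (inner ℂ (c k) (pvGalerkinField κ S β c k)).re =
      -(κ * (4 * Real.pi ^ 2 * (freqNormSq k * ‖c k‖ ^ 2))) -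
        (inner ℂ (c k) (convectionCoeff S β c k)).re := by
    intro k hk
    rw [pvGalerkinField, inner_sub_right, Complex.sub_re, inner_leraySym_right_of_transversal _ _
      (hcT k hk), inner_neg_right, Complex.neg_re, inner_smul_right, Complex.re_ofReal_mul]
    have hcc : (inner ℂ (c k) (c k)).re = ‖c k‖ ^ 2 := inner_self_eq_norm_sq (𝕜 := ℂ) (c k)
    rw [hcc]
    ring
  rw [Finset.sum_congr rfl hsplit, Finset.sum_sub_distrib, Finset.sum_neg_distrib, ← Finset.mul_sum,
    ← Finset.mul_sum, ← toReal_eGradNormSq_realTrigPoly hS hc]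
  have hnl : ∑ k ∈ S, (inner ℂ (c k) (convectionCoeff S β c k)).re = 0 := by
    have h1 := integral_inner_realTrigPoly_left hS hc ((hb.convect hu).memLp 2)
    simp_rw [mFourierCoeff_convect_realTrigPoly hS hβ hc] at h1
    rw [← h1]
    exact integral_inner_convect_right_self_eq_zero hb hbdiv hu
  rw [hnl, sub_zero]

/-! ### Continuity of the field -/

omit [DecidableEq d] in
/-- The field depends continuously on (finitely many coordinates of) the carrier and the state («the
right-hand side of (4.5) is continuous», RRS 2016, Thm. 4.4 Step 1). [cite: RobinsonRodrigoSadowski2016, Thm. 4.4 Step 1 (4.5)] -/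
theorem continuous_pvGalerkinField (κ : ℝ) {X : Type*} [TopologicalSpace X]
    {B C : X → (d → ℤ) → EuclideanSpace ℂ d} (hB : ∀ k, Continuous fun x => B x k)
    (hC : ∀ k, Continuous fun x => C x k) (k : d → ℤ) :
    Continuous fun x => pvGalerkinField κ S (B x) (C x) k := by
  unfold pvGalerkinField
  have h1 : Continuous fun x => ((κ * (4 * Real.pi ^ 2 * freqNormSq k) : ℝ) : ℂ) • C x k :=
    (hC k).const_smul (((κ * (4 * Real.pi ^ 2 * freqNormSq k) : ℝ) : ℂ))
  exact h1.neg.sub ((continuous_leraySym k).comp (continuous_convectionCoeff hB hC k))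

end Field

end Torus

/-! ## The phase space and the field on `S → ℂ^d` -/

section PV

open FunctionSpaces.Torus Torus

variable {d : Type*} [Fintype d]

section Field

variable [DecidableEq d] {S : Finset (d → ℤ)}

variable (S) in
/-- The passive-vector Galerkin field on coefficient vectors: `V(β, c)_k = pvGalerkinField κ S β̄ c̄ k`,
`k ∈ S`, bars denoting extension by zero. [cite: RobinsonRodrigoSadowski2016, Thm. 4.4 Step 1 (4.5)] -/
def pvGalerkinRHS (κ : ℝ) (β c : ↥S → EuclideanSpace ℂ d) : ↥S → EuclideanSpace ℂ d :=
  fun k => pvGalerkinField κ S (coeffExt S β) (coeffExt S c) k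

omit [DecidableEq d] in
/-- Unfolding of `pvGalerkinRHS`. [cite: RobinsonRodrigoSadowski2016, Thm. 4.4 Step 1 (4.5)] -/
theorem pvGalerkinRHS_apply (κ : ℝ) (β c : ↥S → EuclideanSpace ℂ d) (k : ↥S) :
    pvGalerkinRHS S κ β c k = pvGalerkinField κ S (coeffExt S β) (coeffExt S c) k := rfl

omit [DecidableEq d] in
/-- **Invariance of the Galerkin phase space**: for real carrier coefficients the field maps real
divergence-free coefficient vectors to real divergence-free ones (invariance of `P_m H`,
Constantin–Foias 1988, (8.3)–(8.5)). [cite: ConstantinFoias1988, Ch. 8 (8.3)–(8.5)] -/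
theorem pvGalerkinRHS_mem (κ : ℝ) (hS : ∀ k ∈ S, -k ∈ S) {β c : ↥S → EuclideanSpace ℂ d}
    (hβ : IsRealCoeff β) (hc : c ∈ galerkinSubspace S) :
    pvGalerkinRHS S κ β c ∈ galerkinSubspace S := by
  refine ⟨?_, ?_⟩
  · exact isRealCoeff_restrict
      ((hβ.isConjSymm_coeffExt hS).pvGalerkinField κ hS (hc.1.isConjSymm_coeffExt hS))
  · exact isSolenoidalCoeff_restrict
      (isTransversal_pvGalerkinField κ (coeffExt S β) hc.2.isTransversal_coeffExt)

variable (S) in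
/-- **The sector phase space**: real divergence-free coefficient vectors on `S` supported in a frequency
set `Sec` and vanishing at the zero mode — the Fourier coordinates of the Galerkin space intersected with
one Bloch sector and the mean-zero fields. [cite: RobinsonRodrigoSadowski2016, §4.1 (4.1)] -/
def pvPhase (Sec : Set (d → ℤ)) : Submodule ℝ (↥S → EuclideanSpace ℂ d) where
  carrier := {c | c ∈ galerkinSubspace S ∧ ∀ k : ↥S, ((k : d → ℤ) ∉ Sec ∨ (k : d → ℤ) = 0) → c k = 0}
  zero_mem' := ⟨Submodule.zero_mem _, fun k _ => rfl⟩
  add_mem' := by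
    rintro c c' ⟨hc, hcz⟩ ⟨hc', hc'z⟩
    exact ⟨Submodule.add_mem _ hc hc', fun k hk => by simp [hcz k hk, hc'z k hk]⟩
  smul_mem' := by
    rintro a c ⟨hc, hcz⟩
    exact ⟨Submodule.smul_mem _ a hc, fun k hk => by simp [hcz k hk]⟩

omit [DecidableEq d] in
/-- Membership in the sector phase space, unfolded. [cite: ConstantinFoias1988, Ch. 8 (8.3)–(8.5)] -/
theorem mem_pvPhase {Sec : Set (d → ℤ)} {c : ↥S → EuclideanSpace ℂ d} :
    c ∈ pvPhase S Sec ↔ c ∈ galerkinSubspace S ∧ ∀ k : ↥S, ((k : d → ℤ) ∉ Sec ∨ (k : d → ℤ) = 0) → c k = 0 :=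
  Iff.rfl

omit [DecidableEq d] in
/-- **Invariance of the sector phase space**: if `Sec` is stable under translation by the carrier
frequencies (`k - l ∈ Sec`, `β l ≠ 0` ⇒ `k ∈ Sec`) and the carrier is real and transversal, the field maps
`pvPhase S Sec` into itself (Bloch sectors and the zero mode are preserved by the Galerkin flow: the
truncated transport term is a convolution with the finitely many carrier modes, CF 1988 (8.5)). [cite: ConstantinFoias1988, Ch. 8 (8.3)–(8.5)] -/
theorem pvGalerkinRHS_mem_pvPhase (κ : ℝ) (hS : ∀ k ∈ S, -k ∈ S) {Sec : Set (d → ℤ)}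
    {β c : ↥S → EuclideanSpace ℂ d} (hβ : IsRealCoeff β) (hβT : IsSolenoidalCoeff β)
    (hSec : ∀ k l, coeffExt S β l ≠ 0 → k - l ∈ Sec → k ∈ Sec) (hc : c ∈ pvPhase S Sec) :
    pvGalerkinRHS S κ β c ∈ pvPhase S Sec := by
  refine ⟨pvGalerkinRHS_mem κ hS hβ hc.1, fun k hk => ?_⟩
  -- the extension of `c` vanishes off `Sec` and at `0`
  have hcext : ∀ m : d → ℤ, (m ∉ Sec ∨ m = 0) → coeffExt S c m = 0 := by
    intro m hm
    by_cases hmS : m ∈ S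
    · rw [coeffExt_of_mem c hmS]; exact hc.2 ⟨m, hmS⟩ hm
    · exact coeffExt_of_not_mem c hmS
  rw [pvGalerkinRHS_apply]
  rcases hk with hk | hk
  · -- off the sector: support propagation for the set `Sec ∖ {0}` would need `0`-bookkeeping; use `Sec' = {m | m ∈ Sec ∧ m ≠ 0} ∪ …`;
    -- simpler: apply support propagation to the set `{m | m ∈ Sec}` with the state vanishing off `Sec` OR at `0`.
    refine pvGalerkinField_eq_zero_of_support κ (Sec := {m | m ∈ Sec ∧ m ≠ 0} ∪ {m | m ∈ Sec}) ?_ ?_ ?_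
    · intro k' l hβl hkl
      have hkl' : k' - l ∈ Sec := by
        rcases hkl with h | h
        · exact h.1
        · exact h
      exact Or.inr (hSec k' l hβl hkl')
    · intro m hm
      simp only [Set.mem_union, Set.mem_setOf_eq, not_or, not_and, not_not] at hm
      exact hcext m (Or.inl hm.2)
    · simp only [Set.mem_union, Set.mem_setOf_eq, not_or, not_and]
      exact ⟨fun h => absurd h hk, hk⟩
  · rw [hk]
    exact pvGalerkinField_zero_freq κ hβT.isTransversal_coeffExt (hcext 0 (Or.inr rfl))

/-! ### Lipschitz and continuity bounds -/

omit [DecidableEq d] in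
/-- **Linear Lipschitz bound**: `‖V(β, c) - V(β, c')‖ ≤ (|κ| 4π² Λ_S + 2π M_S ‖β‖) ‖c - c'‖` on `S → ℂ^d`
(sup norms; the field is linear in the state). [cite: RobinsonRodrigoSadowski2016, Thm. 4.4 Step 1] -/
theorem norm_pvGalerkinRHS_sub_le (κ : ℝ) (β c c' : ↥S → EuclideanSpace ℂ d) :
    ‖pvGalerkinRHS S κ β c - pvGalerkinRHS S κ β c'‖ ≤
      (‖κ‖ * (4 * Real.pi ^ 2 * ∑ k ∈ S, freqNormSq k) +
        2 * Real.pi * (S.card * ∑ m ∈ S, ∑ j, |(m j : ℝ)|) * ‖β‖) * ‖c - c'‖ := by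
  set Λ : ℝ := ∑ k ∈ S, freqNormSq k with hΛ
  set M : ℝ := S.card * ∑ m ∈ S, ∑ j, |(m j : ℝ)| with hM
  have hM0 : 0 ≤ M := by positivity
  have hΛ0 : 0 ≤ Λ := Finset.sum_nonneg fun k _ => freqNormSq_nonneg k
  have hK : 0 ≤ ‖κ‖ * (4 * Real.pi ^ 2 * Λ) + 2 * Real.pi * M * ‖β‖ := by positivity
  refine (pi_norm_le_iff_of_nonneg (by positivity)).2 fun k => ?_
  rw [Pi.sub_apply, pvGalerkinRHS_apply, pvGalerkinRHS_apply, pvGalerkinField_def, pvGalerkinField_def]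
  have hβl : ∀ l ∈ S, ‖coeffExt S β l‖ ≤ ‖β‖ := fun l _ => norm_coeffExt_le β l
  have hdl : ∀ l ∈ S, ‖(coeffExt S c - coeffExt S c') l‖ ≤ ‖c - c'‖ := fun l _ => by
    rw [← coeffExt_sub]; exact norm_coeffExt_le _ l
  -- the Stokes term
  have h1 : ‖-(((κ * (4 * Real.pi ^ 2 * freqNormSq (k : d → ℤ)) : ℝ) : ℂ) • coeffExt S c k) -
      -(((κ * (4 * Real.pi ^ 2 * freqNormSq (k : d → ℤ)) : ℝ) : ℂ) • coeffExt S c' k)‖ ≤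
      ‖κ‖ * (4 * Real.pi ^ 2 * Λ) * ‖c - c'‖ := by
    rw [neg_sub_neg, ← smul_sub, norm_smul, Complex.norm_real, norm_mul,
      Real.norm_of_nonneg (by have := freqNormSq_nonneg (k : d → ℤ); positivity :
        (0 : ℝ) ≤ 4 * Real.pi ^ 2 * freqNormSq (k : d → ℤ))]
    have hfk : freqNormSq (k : d → ℤ) ≤ Λ := freqNormSq_le_sum k.2
    have hcc : ‖coeffExt S c' k - coeffExt S c k‖ ≤ ‖c - c'‖ := by
      rw [norm_sub_rev]; exact hdl k k.2
    have hνΛ : 0 ≤ ‖κ‖ * (4 * Real.pi ^ 2 * Λ) := by positivity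
    exact mul_le_mul (mul_le_mul_of_nonneg_left (by gcongr) (norm_nonneg κ)) hcc (norm_nonneg _) hνΛ
  -- the projected transport term (linear in the state)
  have h2 : ‖leraySym k (convectionCoeff S (coeffExt S β) (coeffExt S c) k) -
      leraySym k (convectionCoeff S (coeffExt S β) (coeffExt S c') k)‖ ≤
      2 * Real.pi * M * ‖β‖ * ‖c - c'‖ := by
    refine (norm_leraySym_sub_le _ _ _).trans ?_
    rw [← convectionCoeff_sub_right]
    have hb := norm_convectionCoeff_le S (R := ‖β‖) (R' := ‖c - c'‖) hβl hdl (k : d → ℤ)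
    rw [← hM] at hb
    exact hb
  have heq : -(((κ * (4 * Real.pi ^ 2 * freqNormSq (k : d → ℤ)) : ℝ) : ℂ) • coeffExt S c k) -
        leraySym k (convectionCoeff S (coeffExt S β) (coeffExt S c) k) -
        (-(((κ * (4 * Real.pi ^ 2 * freqNormSq (k : d → ℤ)) : ℝ) : ℂ) • coeffExt S c' k) -
          leraySym k (convectionCoeff S (coeffExt S β) (coeffExt S c') k)) =
      (-(((κ * (4 * Real.pi ^ 2 * freqNormSq (k : d → ℤ)) : ℝ) : ℂ) • coeffExt S c k) -
          -(((κ * (4 * Real.pi ^ 2 * freqNormSq (k : d → ℤ)) : ℝ) : ℂ) • coeffExt S c' k)) -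
        (leraySym k (convectionCoeff S (coeffExt S β) (coeffExt S c) k) -
          leraySym k (convectionCoeff S (coeffExt S β) (coeffExt S c') k)) := by
    abel
  rw [heq]
  have hK := (norm_sub_le _ _).trans (add_le_add h1 h2)
  linarith [hK]

omit [DecidableEq d] in
/-- The field vanishes at the zero state (linearity of (4.5) for a prescribed carrier). [cite: RobinsonRodrigoSadowski2016, Thm. 4.4 Step 1 (4.5)] -/
theorem pvGalerkinRHS_zero (κ : ℝ) (β : ↥S → EuclideanSpace ℂ d) : pvGalerkinRHS S κ β 0 = 0 := by
  funext k
  rw [pvGalerkinRHS_apply, coeffExt_zero, pvGalerkinField_def, convectionCoeff_zero_right]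
  simp [leraySym_zero]

omit [DecidableEq d] in
/-- Linear growth bound `‖V(β, c)‖ ≤ L(‖β‖) ‖c‖` («locally Lipschitz», RRS 2016, Thm. 4.4 Step 1). [cite: RobinsonRodrigoSadowski2016, Thm. 4.4 Step 1 (4.5)] -/
theorem norm_pvGalerkinRHS_le (κ : ℝ) (β c : ↥S → EuclideanSpace ℂ d) :
    ‖pvGalerkinRHS S κ β c‖ ≤
      (‖κ‖ * (4 * Real.pi ^ 2 * ∑ k ∈ S, freqNormSq k) +
        2 * Real.pi * (S.card * ∑ m ∈ S, ∑ j, |(m j : ℝ)|) * ‖β‖) * ‖c‖ := by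
  have h := norm_pvGalerkinRHS_sub_le κ β c 0
  rwa [pvGalerkinRHS_zero, sub_zero, sub_zero] at h

omit [DecidableEq d] in
/-- Continuity of the field along continuous carrier and state curves (RRS 2016, Thm. 4.4 Step 1: «the
right-hand side of (4.5) is continuous»). [cite: RobinsonRodrigoSadowski2016, Thm. 4.4 Step 1 (4.5)] -/
theorem ContinuousOn.pvGalerkinRHS (κ : ℝ) {s : Set ℝ} {β α : ℝ → ↥S → EuclideanSpace ℂ d}
    (hβ : ContinuousOn β s) (hα : ContinuousOn α s) :
    ContinuousOn (fun t => pvGalerkinRHS S κ (β t) (α t)) s := by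
  rw [continuousOn_iff_continuous_restrict] at hβ hα ⊢
  refine continuous_pi fun k => ?_
  have h1 : ∀ l : d → ℤ, Continuous fun x : s => coeffExt S (β x) l := by
    intro l
    by_cases hl : l ∈ S
    · simp_rw [coeffExt_of_mem _ hl]
      exact (continuous_apply _).comp hβ
    · simp_rw [coeffExt_of_not_mem _ hl]
      exact continuous_const
  have h2 : ∀ l : d → ℤ, Continuous fun x : s => coeffExt S (α x) l := by
    intro l
    by_cases hl : l ∈ S
    · simp_rw [coeffExt_of_mem _ hl]
      exact (continuous_apply _).comp hα
    · simp_rw [coeffExt_of_not_mem _ hl]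
      exact continuous_const
  exact continuous_pvGalerkinField κ h1 h2 k

omit [DecidableEq d] in
/-- Continuity of the field in time for a fixed state, along a continuous carrier curve. [cite: RobinsonRodrigoSadowski2016, Thm. 4.4 Step 1 (4.5)] -/
theorem continuous_pvGalerkinRHS_left (κ : ℝ) {β : ℝ → ↥S → EuclideanSpace ℂ d} (hβ : Continuous β)
    (c : ↥S → EuclideanSpace ℂ d) : Continuous fun t => pvGalerkinRHS S κ (β t) c := by
  have h := ContinuousOn.pvGalerkinRHS κ (s := Set.univ) hβ.continuousOn (continuousOn_const (c := c))
  exact continuousOn_univ.1 h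

end Field

/-! ## The energy along solutions: identity and decay -/

section Energy

variable [DecidableEq d] {S : Finset (d → ℤ)}

/-- **The energy identity in differential form along a Galerkin solution**: if
`α' = V(β(t), α)` within `s` at `t`, with `α t` real divergence free and `β t` real divergence free, then
`d/dt ∑_k ‖α k‖² = -2κ ‖∇u‖²`, `u = realTrigPoly S ᾱ`
(the `A = 0` energy identity at the Galerkin level). [cite: RobinsonRodrigoSadowski2016, Thm. 4.4 Step 2 (4.6)–(4.7)] -/
theorem hasDerivWithinAt_pvEnergy (κ : ℝ) (hS : ∀ k ∈ S, -k ∈ S)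
    {α : ℝ → ↥S → EuclideanSpace ℂ d} {β : ↥S → EuclideanSpace ℂ d} {s : Set ℝ} {t : ℝ}
    (h : HasDerivWithinAt α (pvGalerkinRHS S κ β (α t)) s t) (hα : α t ∈ galerkinSubspace S)
    (hβ : IsRealCoeff β) (hβT : IsSolenoidalCoeff β) :
    HasDerivWithinAt (fun τ => ∑ k, ‖α τ k‖ ^ 2)
      (2 * -(κ * (eGradNormSq (realTrigPoly S (coeffExt S (α t)))).toReal)) s t := by
  have h1 := hasDerivWithinAt_sum_norm_sq h
  have h2 : ∑ k, 2 * (inner ℂ (α t k) (pvGalerkinRHS S κ β (α t) k)).re =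
      2 * ∑ k ∈ S, (inner ℂ (coeffExt S (α t) k)
        (pvGalerkinField κ S (coeffExt S β) (coeffExt S (α t)) k)).re := by
    rw [Finset.mul_sum, sum_coeffExt (fun k v => 2 * (inner ℂ v
      (pvGalerkinField κ S (coeffExt S β) (coeffExt S (α t)) k)).re)]
    rfl
  rw [h2, sum_re_inner_pvGalerkinField_self κ hS (hβ.isConjSymm_coeffExt hS) hβT.isTransversal_coeffExt
    (hα.1.isConjSymm_coeffExt hS) hα.2.isTransversal_coeffExt] at h1
  exact h1

omit [DecidableEq d] in
/-- **Sector Poincaré inequality at the Galerkin level**: if `c` vanishes at every `k ∈ S` with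
`|k|² < R²`, then `4π² R² ∑_k ‖c k‖² ≤ ‖∇u‖²_{L²}`, `u = realTrigPoly S c̄` (Poincaré on the Fourier
side, `‖∇u‖² = 4π²∑|k|²|û_k|²`; RRS 2016, (4.8) / Ex. 4.1). [cite: RobinsonRodrigoSadowski2016, Thm. 4.4 Step 2 (4.6)–(4.8)] -/
theorem sector_poincare (hS : ∀ k ∈ S, -k ∈ S) {c : ↥S → EuclideanSpace ℂ d} (hc : IsRealCoeff c)
    {R : ℝ} (hR : ∀ k : ↥S, freqNormSq (k : d → ℤ) < R ^ 2 → c k = 0) :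
    4 * Real.pi ^ 2 * R ^ 2 * ∑ k, ‖c k‖ ^ 2 ≤ (eGradNormSq (realTrigPoly S (coeffExt S c))).toReal := by
  rw [toReal_eGradNormSq_realTrigPoly hS (hc.isConjSymm_coeffExt hS), Finset.mul_sum, Finset.mul_sum,
    sum_coeffExt (fun k v => 4 * Real.pi ^ 2 * (freqNormSq k * ‖v‖ ^ 2))]
  refine Finset.sum_le_sum fun k _ => ?_
  by_cases hk : freqNormSq (k : d → ℤ) < R ^ 2
  · rw [hR k hk]; simp
  · push Not at hk
    have h0 : 0 ≤ 4 * Real.pi ^ 2 * ‖c k‖ ^ 2 := by positivity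
    calc 4 * Real.pi ^ 2 * R ^ 2 * ‖c k‖ ^ 2 = (4 * Real.pi ^ 2 * ‖c k‖ ^ 2) * R ^ 2 := by ring
      _ ≤ (4 * Real.pi ^ 2 * ‖c k‖ ^ 2) * freqNormSq (k : d → ℤ) := mul_le_mul_of_nonneg_left hk h0
      _ = 4 * Real.pi ^ 2 * (freqNormSq (k : d → ℤ) * ‖c k‖ ^ 2) := by ring

/-- **Energy decay of Galerkin solutions** (Grönwall). Let `α` solve the Galerkin ODE on `[0, s']`
with `κ ≥ 0`, staying real divergence free and vanishing at every `k` with `|k|² < R²`, along a real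
divergence-free carrier curve `β`. Then `∑_k ‖α t k‖² ≤ e^{-8π²κR²t} ∑_k ‖α 0 k‖²` on `[0, s']`
(`d/dt ∑‖α k‖² = -2κ‖∇u‖² ≤ -8π²κR² ∑‖α k‖²`). With `R = 0`: the energy is non-increasing. [cite: RobinsonRodrigoSadowski2016, Thm. 4.4 Step 2 (4.8)] -/
theorem energy_decay_of_solution (κ : ℝ) (hκ : 0 ≤ κ) (hS : ∀ k ∈ S, -k ∈ S)
    {β : ℝ → ↥S → EuclideanSpace ℂ d} (hβr : ∀ t, IsRealCoeff (β t)) (hβT : ∀ t, IsSolenoidalCoeff (β t))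
    {s' : ℝ} {α : ℝ → ↥S → EuclideanSpace ℂ d}
    (hα : ∀ t ∈ Icc 0 s', HasDerivWithinAt α (pvGalerkinRHS S κ (β t) (α t)) (Icc 0 s') t)
    (hmem : ∀ t ∈ Icc 0 s', α t ∈ galerkinSubspace S) {R : ℝ}
    (hR : ∀ t ∈ Icc 0 s', ∀ k : ↥S, freqNormSq (k : d → ℤ) < R ^ 2 → α t k = 0) :
    ∀ t ∈ Icc 0 s', ∑ k, ‖α t k‖ ^ 2 ≤ Real.exp (-(8 * Real.pi ^ 2 * κ * R ^ 2) * t) * ∑ k, ‖α 0 k‖ ^ 2 := by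
  intro t ht
  set ψ : ℝ → ℝ := fun τ => ∑ k, ‖α τ k‖ ^ 2 with hψ
  set ψ' : ℝ → ℝ := fun τ => 2 * -(κ * (eGradNormSq (realTrigPoly S (coeffExt S (α τ)))).toReal) with hψ'
  have hderiv : ∀ τ ∈ Icc 0 s', HasDerivWithinAt ψ (ψ' τ) (Icc 0 s') τ := fun τ hτ =>
    hasDerivWithinAt_pvEnergy κ hS (hα τ hτ) (hmem τ hτ) (hβr τ) (hβT τ)
  have hcont : ContinuousOn ψ (Icc 0 s') := fun τ hτ => (hderiv τ hτ).continuousWithinAt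
  -- Grönwall with `K = -8π²κR²`, `ε = 0`
  have hbound : ∀ τ ∈ Ico 0 s', ψ' τ ≤ -(8 * Real.pi ^ 2 * κ * R ^ 2) * ψ τ + 0 := by
    intro τ hτ
    have hP := sector_poincare hS (hmem τ (Ico_subset_Icc_self hτ)).1 (hR τ (Ico_subset_Icc_self hτ))
    have : ψ' τ = 2 * -(κ * (eGradNormSq (realTrigPoly S (coeffExt S (α τ)))).toReal) := rfl
    rw [this, add_zero]
    nlinarith
  have hgron := le_gronwallBound_of_liminf_deriv_right_le (f := ψ) (f' := ψ') (δ := ψ 0)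
    (K := -(8 * Real.pi ^ 2 * κ * R ^ 2)) (ε := 0) (a := 0) (b := s') hcont (fun τ hτ r hr => ?_) le_rfl
    hbound t ht
  · rw [sub_zero, gronwallBound_ε0] at hgron
    rw [mul_comm]
    exact hgron
  · have hmem_nhds : Icc 0 s' ∈ 𝓝[Ici τ] τ :=
      mem_nhdsWithin.2 ⟨Iio s', isOpen_Iio, hτ.2, fun z hz => ⟨hτ.1.trans hz.2, hz.1.le⟩⟩
    exact ((hderiv τ (Ico_subset_Icc_self hτ)).mono_of_mem_nhdsWithin hmem_nhds)
      |>.liminf_right_slope_le hr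

end Energy

/-! ## Global solutions of the Galerkin ODE in the sector phase space -/

section Global

variable [DecidableEq d] {S : Finset (d → ℤ)}

/-- **Global existence for the passive-vector Galerkin system in a sector phase space.**
Let `S` be a finite symmetric frequency set, `κ ≥ 0`, `β : ℝ → (S → ℂ^d)` a continuous curve of real
transversal (divergence-free) carrier coefficients, `Sec` a frequency set stable under translation by the
carrier frequencies at all times, and `c₀ ∈ pvPhase S Sec` (real, divergence free, supported in `Sec ∖ {0}`).
Then `α' = V(β(t), α)` has a solution `α : ℝ → (S → ℂ^d)` with `α 0 = c₀`, valued in `pvPhase S Sec`,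
continuous on `[0, ∞)` and solving the equation on every `[0, T]`; its coefficient energy is non-increasing.
Proof: `ODE.exists_solution_of_apriori_bound` on the closed subspace `pvPhase S Sec`, with the linear
Lipschitz bound `norm_pvGalerkinRHS_sub_le` and the a priori bound `energy_decay_of_solution` (`R = 0`). [cite: RobinsonRodrigoSadowski2016, Thm. 4.4 Steps 1–2] -/
theorem exists_pvGalerkin_solution (κ : ℝ) (hκ : 0 ≤ κ) (hS : ∀ k ∈ S, -k ∈ S)
    {β : ℝ → ↥S → EuclideanSpace ℂ d} (hβ : Continuous β) (hβr : ∀ t, IsRealCoeff (β t))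
    (hβT : ∀ t, IsSolenoidalCoeff (β t)) {Sec : Set (d → ℤ)}
    (hSec : ∀ t k l, coeffExt S (β t) l ≠ 0 → k - l ∈ Sec → k ∈ Sec)
    {c₀ : ↥S → EuclideanSpace ℂ d} (hc₀ : c₀ ∈ pvPhase S Sec) :
    ∃ α : ℝ → ↥S → EuclideanSpace ℂ d, α 0 = c₀ ∧ (∀ t, α t ∈ pvPhase S Sec) ∧
      ContinuousOn α (Ici 0) ∧
      (∀ T, ∀ t ∈ Icc 0 T, HasDerivWithinAt α (pvGalerkinRHS S κ (β t) (α t)) (Icc 0 T) t) ∧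
      ∀ t, 0 ≤ t → ∑ k, ‖α t k‖ ^ 2 ≤ ∑ k, ‖c₀ k‖ ^ 2 := by
  set Y := pvPhase S Sec with hY
  set V : ℝ → Y → Y := fun t c =>
    ⟨pvGalerkinRHS S κ (β t) c, pvGalerkinRHS_mem_pvPhase κ hS (hβr t) (hβT t) (hSec t) c.2⟩ with hV
  have hVcoe : ∀ t (c : Y), ((V t c : Y) : ↥S → EuclideanSpace ℂ d) = pvGalerkinRHS S κ (β t) c :=
    fun t c => rfl
  -- Lipschitz, uniformly on `[0, T]` (linear field, continuous carrier)
  have hlip : ∀ T ρ : ℝ, ∃ K : ℝ≥0, ∀ t ∈ Icc 0 T, LipschitzOnWith K (V t) (closedBall 0 ρ) := by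
    intro T ρ
    obtain ⟨Cβ, hCβ⟩ := isCompact_Icc.exists_bound_of_continuousOn (hβ.continuousOn (s := Icc 0 T))
    refine ⟨Real.toNNReal (‖κ‖ * (4 * Real.pi ^ 2 * ∑ k ∈ S, freqNormSq k) +
        2 * Real.pi * (S.card * ∑ m ∈ S, ∑ j, |(m j : ℝ)|) * Cβ), fun t ht => ?_⟩
    refine LipschitzOnWith.of_dist_le_mul fun c _ c' _ => ?_
    rw [Subtype.dist_eq, dist_eq_norm, dist_eq_norm, hVcoe, hVcoe]
    refine (norm_pvGalerkinRHS_sub_le κ (β t) (c : ↥S → EuclideanSpace ℂ d) (c' : ↥S → EuclideanSpace ℂ d)).trans ?_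
    refine mul_le_mul_of_nonneg_right ?_ (norm_nonneg _)
    refine le_trans ?_ (Real.le_coe_toNNReal _)
    have hM : 0 ≤ 2 * Real.pi * ((S.card : ℝ) * ∑ m ∈ S, ∑ j, |(m j : ℝ)|) := by positivity
    nlinarith [hCβ t ht, hM]
  -- continuity in time
  have hcont : ∀ c : Y, ContinuousOn (V · c) (Ici 0) := by
    intro c
    refine Continuous.continuousOn ?_
    exact (continuous_pvGalerkinRHS_left κ hβ (c : ↥S → EuclideanSpace ℂ d)).subtype_mk _
  -- a priori bound from the non-increase of the energy
  have hapriori : ∀ T : ℝ, 0 ≤ T → ∃ R : ℝ, ‖(⟨c₀, hc₀⟩ : Y)‖ ≤ R ∧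
      ∀ s ∈ Icc 0 T, ∀ α : ℝ → Y, α 0 = ⟨c₀, hc₀⟩ →
        (∀ t ∈ Icc 0 s, HasDerivWithinAt α (V t (α t)) (Icc 0 s) t) →
        ∀ t ∈ Icc 0 s, ‖α t‖ ≤ R := by
    intro T hT
    set R : ℝ := Real.sqrt (∑ k, ‖c₀ k‖ ^ 2) with hR
    refine ⟨R, ?_, ?_⟩
    · change ‖c₀‖ ≤ R
      exact norm_le_sqrt_sum_norm_sq c₀
    · intro s hs α hα0 hα t ht
      set γ : ℝ → ↥S → EuclideanSpace ℂ d := fun τ => (α τ : ↥S → EuclideanSpace ℂ d) with hγ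
      have hγ' : ∀ τ ∈ Icc 0 s, HasDerivWithinAt γ (pvGalerkinRHS S κ (β τ) (γ τ)) (Icc 0 s) τ := by
        intro τ hτ
        exact Y.subtypeL.hasFDerivAt.comp_hasDerivWithinAt τ (hα τ hτ)
      have hmem : ∀ τ ∈ Icc 0 s, γ τ ∈ galerkinSubspace S := fun τ _ => (α τ).2.1
      have hdec := energy_decay_of_solution κ hκ hS hβr hβT hγ' hmem (R := 0)
        (fun τ _ k hk => absurd hk (by rw [sq, zero_mul]; exact not_lt.2 (freqNormSq_nonneg _))) t ht
      have hγ0 : γ 0 = c₀ := by simp [hγ, hα0]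
      rw [hγ0] at hdec
      have hdec' : ∑ k, ‖γ t k‖ ^ 2 ≤ ∑ k, ‖c₀ k‖ ^ 2 := by
        refine hdec.trans ?_
        have : Real.exp (-(8 * Real.pi ^ 2 * κ * 0 ^ 2) * t) = 1 := by simp
        rw [this, one_mul]
      change ‖γ t‖ ≤ R
      exact (norm_le_sqrt_sum_norm_sq (γ t)).trans (Real.sqrt_le_sqrt hdec')
  obtain ⟨α, hα0, hα⟩ := ODE.exists_solution_of_apriori_bound hlip hcont hapriori
  have hsol : ∀ T, ∀ t ∈ Icc 0 T, HasDerivWithinAt (fun t => (α t : ↥S → EuclideanSpace ℂ d))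
      (pvGalerkinRHS S κ (β t) (α t)) (Icc 0 T) t := fun T t ht =>
    Y.subtypeL.hasFDerivAt.comp_hasDerivWithinAt t (hα T t ht)
  refine ⟨fun t => (α t : ↥S → EuclideanSpace ℂ d), by simp [hα0], fun t => (α t).2, ?_, hsol, ?_⟩
  · intro t ht
    have hc := IsIntegralCurveOn.continuousOn (hα (t + 1)) t ⟨ht, by linarith⟩
    have hmem : Icc 0 (t + 1) ∈ 𝓝[Ici 0] t :=
      Filter.mem_of_superset (inter_mem_nhdsWithin (Ici (0 : ℝ)) (Iio_mem_nhds (by linarith)))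
        fun s hs => ⟨hs.1, hs.2.le⟩
    exact (continuous_subtype_val.continuousAt.comp_continuousWithinAt hc).mono_of_mem_nhdsWithin
      hmem
  · intro t ht
    have hdec := energy_decay_of_solution κ hκ hS hβr hβT (hsol t) (fun τ _ => (α τ).2.1) (R := 0)
      (fun τ _ k hk => absurd hk (by rw [sq, zero_mul]; exact not_lt.2 (freqNormSq_nonneg _))) t
      ⟨ht, le_rfl⟩
    have h0 : ((α 0 : Y) : ↥S → EuclideanSpace ℂ d) = c₀ := by simp [hα0]
    rw [h0] at hdec
    refine hdec.trans ?_
    have : Real.exp (-(8 * Real.pi ^ 2 * κ * 0 ^ 2) * t) = 1 := by simp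
    rw [this, one_mul]

end Global

end PV

end Literature.Analysis.FluidPDE
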